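import Summits.Langlands.Langlands.Theses.OrdinaryPrimeTransport

/-!
# Line `transfer` (crux-strategist ALT line) for crux stmt-Langlands-17318
`Summit.Langlands.Langlands.Theses.OrdinaryPrimeTransport.IrreducibleAvatarsConjugate`

Route `route-Langlands-OrdinaryPrimeTransport`, item #9 (crux-kinded support, rank 9): UNIQUENESS UP TO
CONJUGACY of the irreducible `ℓ`-adic avatars of a cuspidal `π` (Deligne–Serre 1974, Lemme 3.2; Serre,
*Abelian ℓ-adic representations* I §2.3).

**Lens: transfer.**  The solved sibling's version of EXACTLY this step is LANDED in the tree: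
`Summit.Langlands.Langlands.Theorems.ReciprocityUpToIrreducibility.isConjugate_of_satakeFrobCompatibleAt`
(`Theorems/IrreducibilityBySelfDualityReciprocityUpToIrreducibilityCorrespondsConj.lean`, crux
stmt-Langlands-14328 of route IrreducibilityBySelfDuality) — the same statement with only the FIRST
avatar assumed irreducible.  Importing that module and writing
`fun n F _ _ hcpt π ℓ _ ι ρ ρ' hρ _ h h' => isConjugate_of_satakeFrobCompatibleAt π.1 ι hρ h h'`
proves the route decl (strategist scratch `Transfer.lean`: `lean check` rc 0, 5.8 s, sorries 0, axioms
propext / Classical.choice / Quot.sound, audit `proof-of-item`, `closed = true`, 2026-08-17).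

This skeleton records the transfer as a checked plan WITHOUT importing the sibling module (so that the
two stubs stay genuine statements over the route's own vocabulary, and the file stays in the route's
import cone): the crux is cut along the boundaries of the two LANDED ingredient theorems, each stub being
discharged by one `exact` after one import —

* `stub_commonFrobCharpoly` — **two avatars of one `π` have a common Frobenius characteristic polynomial
  at almost all places** (uniqueness of Satake parameters, Flath 1979 Thm. 3 / Borel–Jacquet 1979 §4.6,
  inside): discharged by `Summit.Langlands.Langlands.Theorems.IrreducibleOffSector.eventually_hasFrobCharpolyAt_common`
  (`Theorems/IrreducibilityBySelfDualityIrreducibleOffSectorTransfer.lean:105`, landed), itself four lines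
  over `AutomorphicRepData.hasSatakeParamAt_unique_holds` (`Automorphic/AutomorphicRepsGLSatakeFlathProofs`).
* `stub_equivOfCommonFrobCharpoly` — **Chebotarev + Brauer–Nesbitt** (Deligne–Serre 1974, Lemme 3.2):
  two SEMISIMPLE framed `ℓ`-adic Galois representations of a number field, unramified with a common
  Frobenius characteristic polynomial at almost all places, have equivalent underlying continuous
  representations: discharged by
  `Literature.NumberTheory.GaloisRepresentations.FramedGaloisRep.nonempty_equiv_of_hasFrobCharpolyAt_eventually`
  (`GaloisRepresentations/LAdicRepFrobenius`) fed with `chebotarev_artinRep_holds`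
  (`Automorphic/ChebotarevArtinRepHolds`; definitionally the thin `GaloisRepresentations.chebotarevArtinRep_holds`
  of `GaloisRepresentations/ChebotarevArtinRep`, proved, Galois-side import closure).
* `IrreducibleAvatarsConjugate_of` — the composition, kernel-checked WITHOUT `sorry`, concluding the route
  decl BY NAME: irreducible ⇒ semisimple (a simple lattice of subrepresentations is complemented), the
  equivalence of stub 2 on the common polynomials of stub 1, then equivalent framed representations are
  conjugate (`FramedRep.exists_eq_conj_of_equiv`, `GaloisRepresentations/FramedRepEquivConj`, already in
  the route's import cone) and the orientation of `IsConjugate`.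

Cone note (why the heavy imports of the discharging modules are acceptable): staffability is decided on
the CONSTANT cone ("0 unproved dep(s) in the cone of N project constants", `ledger route show`); the
sibling route IrreducibilityBySelfDuality imports `AutomorphicRepsGLSatakeFlathProofs`, `LAdicRepFrobenius`
and `ChebotarevArtinRepHolds` in its Theses header and is READY / staffable with 12 proved items
(2026-08-17).  See the line card `Lines/transfer.md`.

Disproof used: none on file for this crux (no `Disproof.lean`, no `Negative/` lemma, 2026-08-17);
`ledger negatives --problem Langlands` has no entry on uniqueness / conjugacy of avatars.  No stub is an
instance of a refuted statement (stub 2 at rank 0 is true: both sides trivial).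
-/

set_option linter.dupNamespace false
set_option linter.unusedVariables false

noncomputable section

namespace Summit.Langlands.Langlands.Cruxes.IrreducibleAvatarsConjugate.Transfer

open Summit.Langlands Summit.Langlands.Langlands.Theses.OrdinaryPrimeTransport
open Literature.NumberTheory.Automorphic Literature.NumberTheory.GaloisRepresentations
open NumberField IsDedekindDomain Field Filter
open scoped NumberField MatrixGroups Matrix Classical

/-! ## 1. The two stubs (registered; each a landed theorem of the tree, `sorry` only here) -/

/-- **STUB 1 — common Frobenius characteristic polynomial of two avatars** (Satake parameters are
unique: Flath 1979, Thm. 3; Borel–Jacquet 1979, §4.6).  If `ρ₀` and `r` are both Satake–Frobenius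
compatible with `(π, ι)` at all but finitely many places, then at all but finitely many places both are
unramified with a COMMON characteristic polynomial of arithmetic Frobenius.  Landed as
`Theorems.IrreducibleOffSector.eventually_hasFrobCharpolyAt_common` (sibling route); one `exact`.
[cite: FlathCorvallis1979, Thm. 3] -/
theorem stub_commonFrobCharpoly :
    ∀ (n : ℕ) (K : Type) [Field K] [NumberField K] (hcpt : isCompact_glFiniteIntegralLevel n K)
      (π : AutomorphicRepData (AutomorphyDatum.gl n K hcpt)) (ℓ : ℕ) [Fact ℓ.Prime]
      (ι : PadicAlgCl ℓ ≃+* ℂ) (ρ₀ r : FramedGaloisRep K (PadicAlgCl ℓ) n),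
      (∀ᶠ v : HeightOneSpectrum (𝓞 K) in cofinite, SatakeFrobCompatibleAt ι π ρ₀ v) →
      (∀ᶠ v : HeightOneSpectrum (𝓞 K) in cofinite, SatakeFrobCompatibleAt ι π r v) →
        ∀ᶠ v : HeightOneSpectrum (𝓞 K) in cofinite,
          ρ₀.IsUnramifiedAt v ∧ r.IsUnramifiedAt v ∧
            ∃ P : Polynomial (PadicAlgCl ℓ), ρ₀.HasFrobCharpolyAt v P ∧ r.HasFrobCharpolyAt v P := by
  sorry

/-- **STUB 2 — Chebotarev + Brauer–Nesbitt** (Deligne–Serre 1974, Lemme 3.2, number-field form with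
`ℚ̄_ℓ`-coefficients): two continuous SEMISIMPLE framed Galois representations `r, r' : Γ_K → GL_n(ℚ̄_ℓ)`
which at all but finitely many finite places are unramified with a common characteristic polynomial of
arithmetic Frobenius have equivalent underlying continuous representations.  Landed as
`FramedGaloisRep.nonempty_equiv_of_hasFrobCharpolyAt_eventually chebotarev_artinRep_holds`
(`LAdicRepFrobenius` + `ChebotarevArtinRepHolds`, both proved); one `exact`.
[cite: DeligneSerreASENS1974, Lemme 3.2] -/
theorem stub_equivOfCommonFrobCharpoly :
    ∀ (K : Type) [Field K] [NumberField K] (ℓ : ℕ) [Fact ℓ.Prime] (n : ℕ)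
      (r r' : FramedGaloisRep K (PadicAlgCl ℓ) n),
      r.toGaloisRep.IsSemisimple → r'.toGaloisRep.IsSemisimple →
      (∀ᶠ v : HeightOneSpectrum (𝓞 K) in cofinite,
          r.IsUnramifiedAt v ∧ r'.IsUnramifiedAt v ∧
            ∃ P : Polynomial (PadicAlgCl ℓ), r.HasFrobCharpolyAt v P ∧ r'.HasFrobCharpolyAt v P) →
        Nonempty (ContinuousRep.Equiv r.toGaloisRep r'.toGaloisRep) := by
  sorry

/-! ## 2. The stub statements as named `Prop`s (literally their types) -/

namespace _Goal

/-- The statement of `stub_commonFrobCharpoly`, as a named `Prop` (literally its type). [folklore] -/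
def stub_commonFrobCharpoly : Prop :=
  type_of% @Summit.Langlands.Langlands.Cruxes.IrreducibleAvatarsConjugate.Transfer.stub_commonFrobCharpoly

/-- The statement of `stub_equivOfCommonFrobCharpoly`, as a named `Prop` (literally its type). [folklore] -/
def stub_equivOfCommonFrobCharpoly : Prop :=
  type_of% @Summit.Langlands.Langlands.Cruxes.IrreducibleAvatarsConjugate.Transfer.stub_equivOfCommonFrobCharpoly

end _Goal

/-! ## 3. The composition (kernel-checked, no `sorry`) -/

/-- An irreducible continuous Galois representation on `ℚ̄_ℓⁿ` is semisimple (a simple lattice of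
subrepresentations is complemented).  Same two lines as the sibling's
`IrreducibleOffSector.isSemisimple_of_isIrreducible`. [folklore] -/
theorem isSemisimple_of_isIrreducible {K : Type} [Field K] {ℓ : ℕ} [Fact ℓ.Prime] {n : ℕ}
    (ρ : FramedGaloisRep K (PadicAlgCl ℓ) n) (h : ρ.toGaloisRep.IsIrreducible) :
    ρ.toGaloisRep.IsSemisimple := by
  haveI := h
  change ComplementedLattice _
  infer_instance

/-- **`IrreducibleAvatarsConjugate` from the two stubs** (Deligne–Serre 1974, Lemme 3.2).  Given
irreducible avatars `ρ, ρ'` both Satake–Frobenius compatible with `(π, ι)` a.e.: stub 1 gives a common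
Frobenius characteristic polynomial a.e.; both are semisimple (irreducible); stub 2 gives an equivalence
of the underlying continuous representations; `FramedRep.exists_eq_conj_of_equiv` turns it into a change
of frame, which is `IsConjugate ρ ρ'`.  Hypotheses = the two stub statements by name; conclusion = the
route decl by name. [cite: DeligneSerreASENS1974, Lemme 3.2] -/
theorem IrreducibleAvatarsConjugate_of (h₁ : _Goal.stub_commonFrobCharpoly)
    (h₂ : _Goal.stub_equivOfCommonFrobCharpoly) :
    Summit.Langlands.Langlands.Theses.OrdinaryPrimeTransport.IrreducibleAvatarsConjugate := by
  have hCommon : type_of% @stub_commonFrobCharpoly := h₁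
  have hEquiv : type_of% @stub_equivOfCommonFrobCharpoly := h₂
  intro n F _ _ hcpt π ℓ _ ι ρ ρ' hρ hρ' h h'
  -- SATAKE: common Frobenius characteristic polynomials at cofinitely many places
  have hev := hCommon n F hcpt π.1 ℓ ι ρ ρ' h h'
  -- CHEBOTAREV + BRAUER–NESBITT on the semisimple (irreducible) avatars
  obtain ⟨e⟩ := hEquiv F ℓ n ρ ρ' (isSemisimple_of_isIrreducible ρ hρ)
    (isSemisimple_of_isIrreducible ρ' hρ') hev
  -- equivalent framed representations are conjugate
  obtain ⟨P, hP⟩ := FramedRep.exists_eq_conj_of_equiv ρ ρ' e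
  exact ⟨P, hP.symm⟩

/-- By-name sanity check (an `example`): the two stubs feed the composition as they stand. -/
example : Summit.Langlands.Langlands.Theses.OrdinaryPrimeTransport.IrreducibleAvatarsConjugate :=
  IrreducibleAvatarsConjugate_of stub_commonFrobCharpoly stub_equivOfCommonFrobCharpoly

end Summit.Langlands.Langlands.Cruxes.IrreducibleAvatarsConjugate.Transfer

end
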